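import Literature.NumberTheory.EllipticCurves.SerreOpenImageReductionInertiaProofs
import Literature.NumberTheory.GaloisRepresentations.DegreeOnePrimesFixedField
import Literature.NumberTheory.GaloisRepresentations.UnramifiedKummer
import Literature.NumberTheory.GaloisRepresentations.LocalFieldPadicProofs
import Literature.NumberTheory.GaloisRepresentations.LocalGaloisGroupHenselProofs
import HarnessLib

/-!
# The tame Kummer character on a global inertia group over `ℓ` is onto (Serre 1972, §1.3)

Topic `NumberTheory/EllipticCurves` (it serves the open image theorem; the statement itself is
pure algebraic number theory).  Theorems only (nothing is defined, no named fact).  J.-P. Serre,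
Invent. Math. 15 (1972), §1.3: for a local field `K` with residue characteristic `p` and `d ≥ 1`,
the extension `K_d = K_nr(π^{1/d})` of the maximal unramified extension is totally (and for
`p ∤ d` tamely) ramified, and *"si `s ∈ Gal(K_d/K_nr)`, il existe une unique racine `d`-ième de
l'unité `θ_d(s)` telle que `s(x^{1/d}) = θ_d(s) x^{1/d}` … l'application `θ_d` ainsi définie est
un isomorphisme"* (Prop. 1–2).  Globally, for a prime `𝔓` of `\bar ℤ` above a rational prime
`ℓ` with inertia group `I_𝔓 ≤ Γ_ℚ`:

* `exists_mem_inertia_smul_eq_mul_of_pow_eq` — **for `π ∈ ℚ̄` with `π^m = ℓ` (`m ≥ 1`) and every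
  `ζ` with `ζ^m = 1` there is `s ∈ I_𝔓` with `s π = ζ π`.**

Proof: the tree proves the local statement for every non-archimedean local field
(`IsNonarchimedeanLocalField.exists_mem_absInertia_smul_eq_mul`, `UnramifiedKummer`), and
`ℚ_ℓ` is one (`Padic.isNonarchimedeanLocalField_holds`) in which `ℓ` is a uniformiser
(`irreducible_natCast_integer_padic`); along the chosen embedding `ι : ℚ̄ → \bar ℚ_ℓ`
(`absClosureEmbedding`) the restriction `Gal(\bar ℚ_ℓ/ℚ_ℓ) → Γ_ℚ` (`absGaloisRestrictMonoidHom`)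
maps the local inertia group into the inertia group of the prime `ι⁻¹(𝔪) ∩ \bar ℤ` above `ℓ`,
and the primes above `ℓ` are conjugate under `Γ_ℚ`.

* `serre_open_image_tame_kummer_input` — the hypothesis `hT` of
  `serre_open_image_of_tame_kummer_surjective` (`SerreOpenImageSupersingularAssemblyProofs`),
  discharged.

## References

* [Serre1972] J.-P. Serre, Invent. Math. 15 (1972) 259–331, §1.3, Prop. 1–2.
* [SerreLocalFields1979] J.-P. Serre, *Local Fields*, Ch. I §6–8, Ch. IV §1–2.
-/

noncomputable section

open scoped Classical NumberField Pointwise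
open IsDedekindDomain Field ValuativeRel

namespace Literature.NumberTheory.EllipticCurves

open Literature.NumberTheory.GaloisRepresentations Rat.HeightOneSpectrum
  Literature.NumberTheory.GaloisRepresentations.IsNonarchimedeanLocalField

/-! ### `ℓ` is a uniformiser of `ℚ_ℓ` (for the valuative structure of Mathlib) -/

/-- Strict monotonicity of multiplication by a nonzero element (local copy). [folklore] -/
private theorem mul_lt_mul_left_of_ne_zero' {Γ₀ : Type*} [LinearOrderedCommGroupWithZero Γ₀]
    {a b c : Γ₀} (hc : c ≠ 0) (h : a < b) : c * a < c * b :=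
  lt_of_le_of_ne (mul_le_mul' le_rfl h.le) fun e ↦ h.ne (mul_left_cancel₀ hc e)

/-- In `ℚ_ℓ`, `ℓ` has the largest valuation below `1` (its additive valuation is `1`).
[folklore] -/
theorem valuation_le_valuation_natCast_of_lt_one (ℓ : ℕ) [Fact ℓ.Prime] {y : ℚ_[ℓ]}
    (hy : valuation ℚ_[ℓ] y < 1) : valuation ℚ_[ℓ] y ≤ valuation ℚ_[ℓ] (ℓ : ℚ_[ℓ]) := by
  have heq : (valuation ℚ_[ℓ]).IsEquiv Padic.mulValuation := ValuativeRel.isEquiv _ _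
  have hy' : Padic.mulValuation y < 1 := heq.lt_one_iff_lt_one.mp hy
  refine (heq y ℓ).mpr ?_
  by_cases hy0 : y = 0
  · rw [hy0, map_zero]; exact zero_le
  have hp0 : (ℓ : ℚ_[ℓ]) ≠ 0 := Nat.cast_ne_zero.mpr (Fact.out : ℓ.Prime).ne_zero
  have e1 : Padic.mulValuation y = WithZero.exp (-y.valuation) := by simp [Padic.mulValuation, hy0]
  have e2 : Padic.mulValuation (ℓ : ℚ_[ℓ]) = WithZero.exp (-1) := by simp [Padic.mulValuation, hp0]
  rw [e1] at hy' ⊢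
  rw [e2, WithZero.exp_le_exp]
  rw [← WithZero.exp_zero, WithZero.exp_lt_exp] at hy'
  omega

/-- **`ℓ` is a uniformiser of `ℚ_ℓ`**: `ℓ` is irreducible in the valuation ring `𝒪[ℚ_ℓ]` of
Mathlib's valuative structure on `ℚ_[ℓ]`. (Serre, *Local Fields*, Ch. II §1.) [folklore] -/
theorem irreducible_natCast_integer_padic (ℓ : ℕ) [Fact ℓ.Prime] :
    Irreducible ((ℓ : ℕ) : 𝒪[ℚ_[ℓ]]) := by
  set w := valuation ℚ_[ℓ] with hw
  have hwI : w.Integers 𝒪[ℚ_[ℓ]] := Valuation.integer.integers _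
  have hunit : ∀ x : 𝒪[ℚ_[ℓ]], IsUnit x ↔ w (x : ℚ_[ℓ]) = 1 := fun x ↦
    Valuation.Integers.isUnit_iff_valuation_eq_one hwI
  have hwℓ : w (ℓ : ℚ_[ℓ]) < 1 := Padic.valuation_p_lt_one _
  have hwℓ0 : w (ℓ : ℚ_[ℓ]) ≠ 0 := Padic.valuation_p_ne_zero _
  have hcoe : (((ℓ : ℕ) : 𝒪[ℚ_[ℓ]]) : ℚ_[ℓ]) = (ℓ : ℚ_[ℓ]) := by push_cast; rfl
  refine ⟨fun hu ↦ hwℓ.ne (by rw [← hcoe]; exact (hunit _).mp hu), fun a b hab ↦ ?_⟩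
  by_contra hne
  rw [not_or] at hne
  obtain ⟨ha, hb⟩ := hne
  have ha1 : w (a : ℚ_[ℓ]) < 1 := lt_of_le_of_ne (hwI.map_le_one a) (fun h ↦ ha ((hunit a).mpr h))
  have hb1 : w (b : ℚ_[ℓ]) < 1 := lt_of_le_of_ne (hwI.map_le_one b) (fun h ↦ hb ((hunit b).mpr h))
  have hab' : w (ℓ : ℚ_[ℓ]) = w (a : ℚ_[ℓ]) * w (b : ℚ_[ℓ]) := by
    rw [← hcoe, hab, Subring.coe_mul, map_mul]
  have hle : w (a : ℚ_[ℓ]) * w (b : ℚ_[ℓ]) ≤ w (ℓ : ℚ_[ℓ]) * w (b : ℚ_[ℓ]) :=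
    mul_le_mul' (valuation_le_valuation_natCast_of_lt_one ℓ ha1) le_rfl
  have hlt : w (ℓ : ℚ_[ℓ]) * w (b : ℚ_[ℓ]) < w (ℓ : ℚ_[ℓ]) * 1 :=
    mul_lt_mul_left_of_ne_zero' hwℓ0 hb1
  rw [mul_one] at hlt
  exact (lt_irrefl _) ((hle.trans_lt hlt).trans_eq hab')

/-! ### Primes of `\bar ℤ` above `p` -/

/-- A prime ideal of `\bar ℤ` containing the rational prime `p` lies above the place of `ℚ` at
`p`. [folklore] -/
theorem mem_primesAbove_of_natCast_mem (p : ℕ) [Fact p.Prime] {v : HeightOneSpectrum (𝓞 ℚ)}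
    (hv : (primesEquiv v : ℕ) = p) {𝔓 : Ideal (absIntegers (𝓞 ℚ) ℚ)} [h𝔓prime : 𝔓.IsPrime]
    (hp𝔓 : ((p : ℕ) : absIntegers (𝓞 ℚ) ℚ) ∈ 𝔓) : 𝔓 ∈ v.primesAbove := by
  refine ⟨h𝔓prime, ⟨?_⟩⟩
  haveI hvmax : v.asIdeal.IsMaximal := v.isPrime.isMaximal v.ne_bot
  haveI : (𝔓.under (𝓞 ℚ)).IsPrime := Ideal.IsPrime.under (𝓞 ℚ) 𝔓
  have hle : v.asIdeal ≤ 𝔓.under (𝓞 ℚ) := by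
    intro x hx
    have hx' : Rat.IsIntegralClosure.intEquiv (𝓞 ℚ) x ∈
        v.asIdeal.map (Rat.IsIntegralClosure.intEquiv (𝓞 ℚ)) := Ideal.mem_map_of_mem _ hx
    rw [← Rat.HeightOneSpectrum.span_natGenerator, Ideal.mem_span_singleton] at hx'
    obtain ⟨c, hc⟩ := hx'
    have hxeq : x = ((Rat.HeightOneSpectrum.natGenerator v : ℕ) : 𝓞 ℚ) *
        (Rat.IsIntegralClosure.intEquiv (𝓞 ℚ)).symm c := by
      apply (Rat.IsIntegralClosure.intEquiv (𝓞 ℚ)).injective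
      rw [map_mul, map_natCast, RingEquiv.apply_symm_apply, ← hc]
    rw [hxeq, Ideal.under_def, Ideal.mem_comap, map_mul, map_natCast]
    refine 𝔓.mul_mem_right _ ?_
    rw [show Rat.HeightOneSpectrum.natGenerator v = p from hv]
    exact hp𝔓
  have hne : 𝔓.under (𝓞 ℚ) ≠ ⊤ := Ideal.IsPrime.ne_top inferInstance
  exact hvmax.eq_of_le hne hle

/-! ### The Kummer step along the embedding `ℚ̄ → \bar ℚ_ℓ` -/

/-- **Surjectivity of the tame Kummer character on a global inertia group, at the prime cut
out by an embedding into `\bar ℚ_ℓ`.**  For the chosen `ι : ℚ̄ → \bar ℚ_ℓ` let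
`𝔓 = ι⁻¹(𝔪) ∩ \bar ℤ` (a prime of `\bar ℤ` above `ℓ`); then for `π^m = ℓ` and `ζ^m = 1` in `ℚ̄`
some `s ∈ I_𝔓 ≤ Γ_ℚ` has `s π = ζ π` — the restriction of the local `σ ∈ I_{ℚ_ℓ}` with
`σ (ι π) = ι ζ · ι π` of the tree's local theorem (`UnramifiedKummer`).
[cite: Serre1972, §1.3 Prop. 1–2] -/
theorem exists_mem_primesAbove_forall_exists_mem_inertia_smul_eq (ℓ : ℕ) [Fact ℓ.Prime]
    {m : ℕ} (hm : 0 < m) {v : HeightOneSpectrum (𝓞 ℚ)} (hv : (primesEquiv v : ℕ) = ℓ) :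
    ∃ 𝔓 ∈ v.primesAbove, ∀ π ζ : AlgebraicClosure ℚ, π ^ m = ℓ → ζ ^ m = 1 →
      ∃ s ∈ 𝔓.inertia (absoluteGaloisGroup ℚ), s • π = ζ * π := by
  haveI : IsNonarchimedeanLocalField ℚ_[ℓ] := Padic.isNonarchimedeanLocalField_holds ℓ
  set ι : AlgebraicClosure ℚ →ₐ[ℚ] AlgebraicClosure ℚ_[ℓ] := absClosureEmbedding ℚ ℚ_[ℓ] with hι
  set res : absoluteGaloisGroup ℚ_[ℓ] →* absoluteGaloisGroup ℚ :=
    absGaloisRestrictMonoidHom ℚ ℚ_[ℓ] with hres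
  have hcompat : ∀ (σ : absoluteGaloisGroup ℚ_[ℓ]) (x : AlgebraicClosure ℚ),
      ι (res σ • x) = σ • ι x := absClosureEmbedding_absGaloisRestrictMonoidHom_smul ℚ ℚ_[ℓ]
  -- `ι` maps `\bar ℤ` into the integral closure `S` of `𝒪[ℚ_ℓ]`
  haveI : IsScalarTower ℤ 𝒪[ℚ_[ℓ]] (AlgebraicClosure ℚ_[ℓ]) :=
    IsScalarTower.of_algebraMap_eq' (Subsingleton.elim _ _)
  have hint : ∀ x : absIntegers (𝓞 ℚ) ℚ, IsIntegral 𝒪[ℚ_[ℓ]] (ι x) := by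
    intro x
    have h1 : IsIntegral ℤ (x : AlgebraicClosure ℚ) := isIntegral_int_of_isIntegral x.2
    have h2 : IsIntegral ℤ (ι x) := h1.map (ι.restrictScalars ℤ)
    exact h2.tower_top
  set φ : absIntegers (𝓞 ℚ) ℚ →+* absIntegers 𝒪[ℚ_[ℓ]] ℚ_[ℓ] :=
    { toFun := fun x ↦ ⟨ι x, (mem_integralClosure_iff _ _).mpr (hint x)⟩
      map_one' := Subtype.ext (by
        change ι ((1 : absIntegers (𝓞 ℚ) ℚ) : AlgebraicClosure ℚ) = 1
        rw [OneMemClass.coe_one, map_one])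
      map_mul' := fun x y ↦ Subtype.ext (by
        change ι ((x * y : absIntegers (𝓞 ℚ) ℚ) : AlgebraicClosure ℚ) = ι x * ι y
        rw [MulMemClass.coe_mul, map_mul])
      map_zero' := Subtype.ext (by
        change ι ((0 : absIntegers (𝓞 ℚ) ℚ) : AlgebraicClosure ℚ) = 0
        rw [ZeroMemClass.coe_zero, map_zero])
      map_add' := fun x y ↦ Subtype.ext (by
        change ι ((x + y : absIntegers (𝓞 ℚ) ℚ) : AlgebraicClosure ℚ) = ι x + ι y
        rw [AddMemClass.coe_add, map_add]) } with hφ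
  have hφ_apply : ∀ x : absIntegers (𝓞 ℚ) ℚ, (φ x : AlgebraicClosure ℚ_[ℓ]) = ι x := fun _ ↦ rfl
  haveI hmax : (absMaximalIdeal ℚ_[ℓ]).IsMaximal := absMaximalIdeal_isMaximal_holds ℚ_[ℓ]
  set 𝔓 : Ideal (absIntegers (𝓞 ℚ) ℚ) := (absMaximalIdeal ℚ_[ℓ]).comap φ with h𝔓
  haveI h𝔓prime : 𝔓.IsPrime := Ideal.comap_isPrime φ _
  -- `ℓ ∈ 𝔓`: `ℓ ∈ 𝓂[ℚ_ℓ]` and `𝓂 S ⊆ 𝔪 = rad(𝓂 S)`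
  have hℓ𝓂 : ((ℓ : ℕ) : 𝒪[ℚ_[ℓ]]) ∈ 𝓂[ℚ_[ℓ]] :=
    (IsLocalRing.mem_maximalIdeal _).mpr (irreducible_natCast_integer_padic ℓ).not_isUnit
  have hℓ𝔓 : ((ℓ : ℕ) : absIntegers (𝓞 ℚ) ℚ) ∈ 𝔓 := by
    rw [h𝔓, Ideal.mem_comap, map_natCast]
    change _ ∈ Ideal.radical _
    refine Ideal.le_radical ?_
    have : ((ℓ : ℕ) : absIntegers 𝒪[ℚ_[ℓ]] ℚ_[ℓ]) =
        algebraMap 𝒪[ℚ_[ℓ]] (absIntegers 𝒪[ℚ_[ℓ]] ℚ_[ℓ]) (ℓ : 𝒪[ℚ_[ℓ]]) := by rw [map_natCast]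
    rw [this]
    exact Ideal.mem_map_of_mem _ hℓ𝓂
  refine ⟨𝔓, mem_primesAbove_of_natCast_mem ℓ hv hℓ𝔓, fun π ζ hπ hζ ↦ ?_⟩
  -- the local Kummer theorem for `z = ι π`, `ζ' = ι ζ`
  have hz : (ι π) ^ m = algebraMap 𝒪[ℚ_[ℓ]] (AlgebraicClosure ℚ_[ℓ]) ((ℓ : ℕ) : 𝒪[ℚ_[ℓ]]) := by
    rw [← map_pow, hπ, map_natCast, map_natCast]
  have hζ' : (ι ζ) ^ m = 1 := by rw [← map_pow, hζ, map_one]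
  obtain ⟨σ, hσI, hσz⟩ :=
    exists_mem_absInertia_smul_eq_mul hm (irreducible_natCast_integer_padic ℓ) hz hζ'
  -- `res σ ∈ I_𝔓`
  have hresI : res σ ∈ 𝔓.inertia (absoluteGaloisGroup ℚ) := by
    intro x
    change φ (res σ • x - x) ∈ absMaximalIdeal ℚ_[ℓ]
    rw [map_sub]
    have hφσ : φ (res σ • x) = σ • φ x := Subtype.ext (by
      rw [hφ_apply, integralClosure.coe_smul, integralClosure.coe_smul, hφ_apply]
      exact hcompat σ x)
    rw [hφσ]
    exact (mem_absInertia_iff.mp hσI) (φ x)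
  refine ⟨res σ, hresI, ι.toRingHom.injective ?_⟩
  change ι (res σ • π) = ι (ζ * π)
  rw [hcompat σ π, hσz, map_mul]

set_option synthInstance.maxHeartbeats 100000 in
/-- **Surjectivity of the tame Kummer character on every global inertia group above `ℓ`**
(Serre 1972, §1.3, Prop. 1–2, global form): for every prime `𝔓` of `\bar ℤ` above `ℓ`, every
`π ∈ ℚ̄` with `π^m = ℓ` (`m ≥ 1`) and every `ζ` with `ζ^m = 1` there is `s ∈ I_𝔓 ≤ Γ_ℚ` with
`s π = ζ π`.  (The primes above `ℓ` are conjugate under `Γ_ℚ`,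
`HeightOneSpectrum.exists_smul_eq_of_mem_primesAbove_holds`, and the statement is covariant.)
[cite: Serre1972, §1.3 Prop. 1–2] -/
theorem exists_mem_inertia_smul_eq_mul_of_pow_eq (ℓ : ℕ) [Fact ℓ.Prime] {m : ℕ} (hm : 0 < m)
    {v : HeightOneSpectrum (𝓞 ℚ)} (hv : (primesEquiv v : ℕ) = ℓ)
    {𝔓 : Ideal (absIntegers (𝓞 ℚ) ℚ)} (h𝔓 : 𝔓 ∈ v.primesAbove)
    {π ζ : AlgebraicClosure ℚ} (hπ : π ^ m = ℓ) (hζ : ζ ^ m = 1) :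
    ∃ s ∈ 𝔓.inertia (absoluteGaloisGroup ℚ), s • π = ζ * π := by
  obtain ⟨𝔓₀, h𝔓₀, hT⟩ := exists_mem_primesAbove_forall_exists_mem_inertia_smul_eq ℓ hm hv
  obtain ⟨g, hg⟩ :=
    HeightOneSpectrum.exists_smul_eq_of_mem_primesAbove_holds (K := ℚ) (v := v) h𝔓₀ h𝔓
  have hℓfix : ∀ τ : absoluteGaloisGroup ℚ, τ • ((ℓ : ℕ) : AlgebraicClosure ℚ) = ℓ := fun τ ↦ by
    rw [absoluteGaloisGroup.smul_def, map_natCast]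
  have hπ' : (g⁻¹ • π) ^ m = ℓ := by rw [← smul_pow', hπ, hℓfix]
  have hζ' : (g⁻¹ • ζ) ^ m = 1 := by rw [← smul_pow', hζ, smul_one]
  obtain ⟨s', hs'I, hs'⟩ := hT (g⁻¹ • π) (g⁻¹ • ζ) hπ' hζ'
  refine ⟨g * s' * g⁻¹, ?_, ?_⟩
  · rw [← hg]
    have hs'' : s' ∈ ((g⁻¹ • (g • 𝔓₀) : Ideal (absIntegers (𝓞 ℚ) ℚ))).inertia
        (absoluteGaloisGroup ℚ) := by rwa [inv_smul_smul]
    have := DegreeOnePrimes.conj_mem_inertia_of_mem_inertia_smul hs''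
    rwa [inv_inv] at this
  · rw [mul_smul, mul_smul, hs', smul_mul', smul_inv_smul, smul_inv_smul]

end Literature.NumberTheory.EllipticCurves
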